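import Literature.Analysis.FluidPDE.AxisymPoloidalPart
import HarnessLib

/-!
# The cut-off poloidal part `Ṽ = ψ V^a`: vorticity, divergence and the `L²` gradient bound

Analysis/FluidPDE support file (everything proved; no definitions) on the decomposition path of
the named fact `SereginZajaczkowski2007.OffAxisPoloidalBound` (G. Seregin, W. Zajaczkowski,
SIAM J. Math. Anal. 39 (2007) 669–685 = arXiv:math/0702720, Lemma 4.2). In the proof of that lemma
one multiplies the poloidal part `V^a = (V_ϱ, V₃)` of a smooth axially symmetric divergence-free
field by a cut-off `ψ` supported in the shell `𝒞̃`, `Ṽ = V^a ψ`, records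

> (4.6) `Ṽ_{ϱ,ϱ} + Ṽ_{3,3} = -Ṽ_ϱ/ϱ + V_ϱ ψ_{,ϱ} + V₃ ψ_{,3}`,
> (4.7) `Ṽ_{ϱ,3} - Ṽ_{3,ϱ} = χ̃ + V_ϱ ψ_{,3} - V₃ ψ_{,ϱ}` (`χ̃ = χψ`, `χ = ω_φ`),

and concludes "According to (4.6) and (4.7), one may conclude
`∫∫ |∇_a Ṽ|² dϱ dx₃ ≤ c ∫∫ (|χ̃|² + |V^a|²) dϱ dx₃`" (arXiv p. 6) — the `div`–`curl` estimate for the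
compactly supported planar field `Ṽ`.

This file proves the three-dimensional, coordinate-free form of that step for the field
`y ↦ ψ y • poloidalPart u y` on `ℝ³` (accepted `poloidalPart`), for `u` of class `C²`, axially
symmetric and divergence free on an open set `Ω` lying off the axis, and a `C²` axisymmetric
cut-off `ψ` with `tsupport ψ ⊆ Ω`:

* `contDiff_smul_poloidalPart`, `hasCompactSupport_smul_poloidalPart`,
  `isAxisymmetric_smul_poloidalPart`, `hasNoSwirl_smul_poloidalPart`: `ψ V^a` is a `C²`, compactly
  supported, axially symmetric, swirl-free field on all of `ℝ³`;
* (4.6) `divergence_smul_poloidalPart`: `div (ψ V^a) = Dψ(V^a)` (= `V^a · ∇ψ`; the term `-Ṽ_ϱ/ϱ`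
  of (4.6) is the difference between the planar and the three-dimensional divergence);
* (4.7) `norm_curl_smul_poloidalPart_le`: `‖curl (ψ V^a)‖ ≤ |ψ| |ω_φ| + ‖curlCLM‖ ‖Dψ‖ ‖V^a‖`
  (for a swirl-free axisymmetric field the curl is `(curl ·)_φ e_φ`, accepted
  `curl_apply_two_eq_zero`, `inner_curl_horizontal_eq_zero`; its `φ`-component is
  `ψ ω_φ + (∇ψ × V^a)_φ` by the Leibniz rule and `(curl V^a)_φ = ω_φ`);
* the `div`–`curl` identity for compactly supported `C²` fields,
  `integral_frobeniusNormSq_fderiv_eq_of_hasCompactSupport`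
  (`∫ |Dv|²_F = ∫ ‖curl v‖² + ∫ (div v)²`, from the accepted pointwise identity
  `frobeniusNormSq_fderiv_eq_sq_norm_curl_add_trace` and
  `integral_mul_trace_comp_sub_divergence_sq` with a cut-off equal to `1` on the support);
* the conclusion `integral_frobeniusNormSq_fderiv_smul_poloidalPart_le`:
  `∫ |D(ψ V^a)|²_F ≤ 2 ∫ ψ² ω_φ² + (2 ‖curlCLM‖² + 1) ∫ ‖Dψ‖² ‖V^a‖²`.

## References

* G. Seregin, W. Zajaczkowski, SIAM J. Math. Anal. 39 (2007) 669–685, arXiv:math/0702720, proof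
  of Lemma 4.2, (4.6)–(4.7) and the display "According to (4.6) and (4.7)" (arXiv p. 6).
  [`SereginZajaczkowski2007`]
-/

noncomputable section

open MeasureTheory Set Function Filter Topology TopologicalSpace Metric InnerProductSpace
open scoped RealInnerProductSpace ENNReal NNReal Topology

namespace Literature.Analysis.FluidPDE

/-! ### The `div`–`curl` identity for compactly supported fields -/

/-- **The `div`–`curl` identity for compactly supported fields**: for `v ∈ C²_c(ℝ³; ℝ³)`,
`∫ |Dv|²_F dx = ∫ ‖curl v‖² dx + ∫ (div v)² dx` (pointwise `|Dv|²_F = ‖curl v‖² + tr (Dv ∘ Dv)`,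
accepted `frobeniusNormSq_fderiv_eq_sq_norm_curl_add_trace`, and `∫ tr (Dv ∘ Dv) = ∫ (div v)²`
by the divergence theorem without boundary, accepted `integral_mul_trace_comp_sub_divergence_sq`
with a cut-off equal to `1` on the support of `v`). [folklore] -/
theorem integral_frobeniusNormSq_fderiv_eq_of_hasCompactSupport
    {v : EuclideanSpace ℝ (Fin 3) → EuclideanSpace ℝ (Fin 3)} (hv : ContDiff ℝ 2 v)
    (hvc : HasCompactSupport v) :
    ∫ x, frobeniusNormSq (fderiv ℝ v x) =
      (∫ x, ‖curl v x‖ ^ 2) + ∫ x, VectorCalculus.divergence v x ^ 2 := by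
  have hv1 : ContDiff ℝ 1 v := hv.of_le (by simp)
  -- a cut-off equal to `1` on the support of `v`
  obtain ⟨R, hR⟩ := hvc.isCompact.isBounded.subset_closedBall (0 : EuclideanSpace ℝ (Fin 3))
  set R' : ℝ := max R 1 with hR'
  have hR'0 : 0 < R' := lt_of_lt_of_le one_pos (le_max_right _ _)
  have hsub : tsupport v ⊆ closedBall (0 : EuclideanSpace ℝ (Fin 3)) R' :=
    hR.trans (closedBall_subset_closedBall (le_max_left _ _))
  set φ : EuclideanSpace ℝ (Fin 3) → ℝ := cutoff R' with hφ
  have hφ1 : ContDiff ℝ 1 φ := contDiff_cutoff (n := 1) R'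
  have hφc : HasCompactSupport φ := hasCompactSupport_cutoff hR'0
  have hφone : ∀ x ∈ tsupport v, φ x = 1 := fun x hx =>
    cutoff_eq_one hR'0 (by simpa [dist_zero_right] using hsub hx)
  -- `Dφ = 0` on the support of `v`, so the boundary-free identity has no error term
  have key := integral_mul_trace_comp_sub_divergence_sq hv hφ1 hφc
  have hrhs : ∫ x, fderiv ℝ φ x (fderiv ℝ v x (v x) - VectorCalculus.divergence v x • v x) = 0 := by
    refine integral_eq_zero_of_ae (Eventually.of_forall fun x => ?_)
    by_cases hx' : v x = 0
    · have hD : fderiv ℝ v x (v x) = 0 := by rw [hx', map_zero]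
      simp [hx']
    · have hopen : IsOpen (Function.support v) := hv.continuous.isOpen_support
      have hloc : φ =ᶠ[𝓝 x] fun _ => (1 : ℝ) := by
        filter_upwards [hopen.mem_nhds hx'] with y hy
        exact hφone y (subset_tsupport _ hy)
      have hD : fderiv ℝ φ x = 0 := by
        rw [hloc.fderiv_eq, fderiv_const_apply]
      simp [hD]
  rw [hrhs, neg_zero] at key
  have hc2 : Continuous fun x => traceCLM ((fderiv ℝ v x).comp (fderiv ℝ v x)) :=
    traceCLM.continuous.comp (((ContinuousLinearMap.compL ℝ (EuclideanSpace ℝ (Fin 3))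
      (EuclideanSpace ℝ (Fin 3)) (EuclideanSpace ℝ (Fin 3))).continuous₂).comp
      ((hv1.continuous_fderiv one_ne_zero).prodMk (hv1.continuous_fderiv one_ne_zero)))
  have hcd : Continuous fun x => VectorCalculus.divergence v x ^ 2 :=
    (continuous_divergence (hv1.continuous_fderiv one_ne_zero)).pow 2
  have hcc : Continuous fun x => ‖curl v x‖ ^ 2 := by
    rw [curl_eq_curlCLM_comp]
    exact (curlCLM.continuous.comp (hv1.continuous_fderiv one_ne_zero)).norm.pow 2
  have hD0 : ∀ x ∉ tsupport v, fderiv ℝ v x = 0 := fun x hx =>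
    image_eq_zero_of_notMem_tsupport fun h => hx (tsupport_fderiv_subset ℝ h)
  have htr0 : ∀ x ∉ tsupport v, traceCLM ((fderiv ℝ v x).comp (fderiv ℝ v x)) = 0 := fun x hx => by
    simp [hD0 x hx]
  have hdiv0 : ∀ x ∉ tsupport v, VectorCalculus.divergence v x ^ 2 = 0 := fun x hx => by
    rw [divergence_eq_zero_of_notMem_tsupport hx]; ring
  have hφmul : ∀ g : EuclideanSpace ℝ (Fin 3) → ℝ, (∀ x ∉ tsupport v, g x = 0) →
      (fun x => φ x * g x) = g := by
    intro g hg
    funext x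
    by_cases hx : x ∈ tsupport v
    · rw [hφone x hx, one_mul]
    · rw [hg x hx, mul_zero]
  have hi2 : Integrable fun x => traceCLM ((fderiv ℝ v x).comp (fderiv ℝ v x)) :=
    hc2.integrable_of_hasCompactSupport (HasCompactSupport.intro hvc.isCompact htr0)
  have hi3 : Integrable fun x => VectorCalculus.divergence v x ^ 2 :=
    hcd.integrable_of_hasCompactSupport (HasCompactSupport.intro hvc.isCompact hdiv0)
  have e1 : ∫ x, φ x * (traceCLM ((fderiv ℝ v x).comp (fderiv ℝ v x)) -
      VectorCalculus.divergence v x ^ 2) =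
      (∫ x, traceCLM ((fderiv ℝ v x).comp (fderiv ℝ v x))) -
        ∫ x, VectorCalculus.divergence v x ^ 2 := by
    rw [hφmul _ (fun x hx => by rw [htr0 x hx, hdiv0 x hx, sub_zero])]
    exact integral_sub hi2 hi3
  rw [e1, sub_eq_zero] at key
  have hi1 : Integrable fun x => ‖curl v x‖ ^ 2 := by
    refine hcc.integrable_of_hasCompactSupport (HasCompactSupport.intro hvc.isCompact fun x hx => ?_)
    rw [curl_eq_curlCLM_comp]
    simp [hD0 x hx]
  simp_rw [frobeniusNormSq_fderiv_eq_sq_norm_curl_add_trace]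
  rw [integral_add hi1 hi2, key]

/-! ### Small algebra: swirl of a scalar multiple, norm of `e_φ`, the curl of a poloidal field -/

/-- `swirl (ψ • v) = ψ · swirl v` pointwise. [folklore] -/
theorem swirl_fun_smul (ψ : EuclideanSpace ℝ (Fin 3) → ℝ)
    (v : EuclideanSpace ℝ (Fin 3) → EuclideanSpace ℝ (Fin 3)) (y : EuclideanSpace ℝ (Fin 3)) :
    swirl (fun x => ψ x • v x) y = ψ y * swirl v y := by
  simp only [swirl, PiLp.smul_apply, smul_eq_mul]
  ring

/-- `|⟪w, e_φ⟫| ≤ ‖w‖` (`‖e_φ‖ ≤ 1`, with the junk value `0` on the axis). [folklore] -/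
theorem abs_swirlVelocity_le (w : EuclideanSpace ℝ (Fin 3) → EuclideanSpace ℝ (Fin 3))
    (y : EuclideanSpace ℝ (Fin 3)) : |swirlVelocity w y| ≤ ‖w y‖ := by
  have hθ : ‖eTheta y‖ ≤ 1 := by
    have hn : ‖(WithLp.toLp 2 ![-y 1, y 0, (0 : ℝ)] : EuclideanSpace ℝ (Fin 3))‖ = cylRadius y := by
      rw [EuclideanSpace.norm_eq, cylRadius]
      congr 1
      simp [Fin.sum_univ_three]
      ring
    rw [eTheta, norm_smul, hn, norm_inv, Real.norm_eq_abs, abs_of_nonneg (cylRadius_nonneg y)]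
    by_cases hr : cylRadius y = 0
    · simp [hr]
    · rw [inv_mul_cancel₀ hr]
  calc |swirlVelocity w y| ≤ ‖w y‖ * ‖eTheta y‖ := abs_real_inner_le_norm _ _
    _ ≤ ‖w y‖ * 1 := by gcongr
    _ = ‖w y‖ := mul_one _

/-- **The curl of a swirl-free axisymmetric `C¹` field is toroidal**: `‖curl v‖ = |(curl v)_φ|`,
in the junk-free form `‖curl v y‖² = (swirlVelocity (curl v) y)²` (accepted
`curl_apply_two_eq_zero`: `ω₃ = 0`; `inner_curl_horizontal_eq_zero`: `y₀ω₀ + y₁ω₁ = 0`; then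
`ϱ²(ω₀² + ω₁²) = (y₀ω₀ + y₁ω₁)² + (y₀ω₁ - y₁ω₀)²`; on the axis both sides vanish as soon as
`curl v = 0` there). [folklore] -/
theorem norm_curl_sq_eq_swirlVelocity_sq {v : EuclideanSpace ℝ (Fin 3) → EuclideanSpace ℝ (Fin 3)}
    (hax : IsAxisymmetric v) (hsw : HasNoSwirl v) (hv : ContDiff ℝ 1 v) {y : EuclideanSpace ℝ (Fin 3)}
    (hy : cylRadius y ≠ 0 ∨ curl v y = 0) :
    ‖curl v y‖ ^ 2 = swirlVelocity (curl v) y ^ 2 := by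
  rcases eq_or_ne (cylRadius y) 0 with hr | hr
  · have h0 : curl v y = 0 := hy.resolve_left (fun h => h hr)
    simp [swirlVelocity, h0]
  · have h2 := curl_apply_two_eq_zero hax hsw hv y
    have hh := inner_curl_horizontal_eq_zero hax hsw ((hv.differentiable one_ne_zero) y)
    have hsv : cylRadius y * swirlVelocity (curl v) y = y 0 * curl v y 1 - y 1 * curl v y 0 := by
      rw [← swirl_eq_cylRadius_mul_swirlVelocity _ hr]; rfl
    have hr2 : cylRadius y ^ 2 = y 0 ^ 2 + y 1 ^ 2 := cylRadius_sq y
    have hn : ‖curl v y‖ ^ 2 = curl v y 0 ^ 2 + curl v y 1 ^ 2 := by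
      rw [EuclideanSpace.norm_eq, Real.sq_sqrt (by positivity)]
      simp [Fin.sum_univ_three, h2]
    have hmul : cylRadius y ^ 2 * ‖curl v y‖ ^ 2 = cylRadius y ^ 2 * swirlVelocity (curl v) y ^ 2 := by
      rw [hn, show cylRadius y ^ 2 * swirlVelocity (curl v) y ^ 2 =
        (cylRadius y * swirlVelocity (curl v) y) ^ 2 by ring, hsv]
      linear_combination (curl v y 0 ^ 2 + curl v y 1 ^ 2) * hr2 +
        (y 0 * curl v y 0 + y 1 * curl v y 1) * hh
    exact mul_left_cancel₀ (pow_ne_zero 2 hr) hmul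

/-! ### The cut-off poloidal part -/

section Cutoff

variable {u : EuclideanSpace ℝ (Fin 3) → EuclideanSpace ℝ (Fin 3)} {ψ : EuclideanSpace ℝ (Fin 3) → ℝ}
  {Ω : Set (EuclideanSpace ℝ (Fin 3))} {ρ₀ : ℝ}

/-- Off the support of the cut-off the product vanishes near the point. [folklore] -/
theorem smul_poloidalPart_eventuallyEq_zero {y : EuclideanSpace ℝ (Fin 3)} (hy : y ∉ tsupport ψ) :
    (fun x => ψ x • poloidalPart u x) =ᶠ[𝓝 y] fun _ => 0 := by
  filter_upwards [notMem_tsupport_iff_eventuallyEq.1 hy] with x hx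
  rw [hx, Pi.zero_apply, zero_smul]

/-- **`ψ V^a` is `C²` on all of `ℝ³`** when `u` is `C²` on an open set `Ω` off the axis containing
the support of the `C²` cut-off `ψ`. [folklore] -/
theorem contDiff_smul_poloidalPart (h0 : 0 < ρ₀) (hΩρ : ∀ y ∈ Ω, ρ₀ ≤ cylRadius y)
    (hu : ∀ y ∈ Ω, ContDiffAt ℝ 2 u y) (hψ : ContDiff ℝ 2 ψ) (hψΩ : tsupport ψ ⊆ Ω) :
    ContDiff ℝ 2 fun y => ψ y • poloidalPart u y := by
  rw [contDiff_iff_contDiffAt]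
  intro y
  by_cases hy : y ∈ tsupport ψ
  · have hyΩ : y ∈ Ω := hψΩ hy
    have hr : cylRadius y ≠ 0 := (h0.trans_le (hΩρ y hyΩ)).ne'
    exact hψ.contDiffAt.smul (contDiffAt_poloidalPart (hu y hyΩ) hr)
  · exact contDiffAt_const.congr_of_eventuallyEq (smul_poloidalPart_eventuallyEq_zero hy)

/-- `ψ V^a` is compactly supported (inside `tsupport ψ`). [folklore] -/
theorem hasCompactSupport_smul_poloidalPart (hψc : HasCompactSupport ψ) :
    HasCompactSupport fun y => ψ y • poloidalPart u y :=
  hψc.smul_right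

/-- The support of `ψ V^a` lies in the support of `ψ`. [folklore] -/
theorem tsupport_smul_poloidalPart_subset :
    tsupport (fun y => ψ y • poloidalPart u y) ⊆ tsupport ψ :=
  tsupport_smul_subset_left _ _

/-- **`ψ V^a` is axially symmetric on all of `ℝ³`** when `ψ` is an axisymmetric scalar supported
in `Ω` and `u` is equivariant at the points of `Ω`. [folklore] -/
theorem isAxisymmetric_smul_poloidalPart (hrot : ∀ θ : ℝ, ∀ y ∈ Ω, u (rotZ θ y) = rotZ θ (u y))
    (hψa : IsAxisymmetricScalar ψ) (hψΩ : tsupport ψ ⊆ Ω) :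
    IsAxisymmetric fun y => ψ y • poloidalPart u y := by
  intro θ y
  have hlin : rotZ θ (ψ y • poloidalPart u y) = ψ y • rotZ θ (poloidalPart u y) := by
    have := (rotZLIE θ).map_smul (ψ y) (poloidalPart u y)
    simpa only [rotZLIE_apply] using this
  dsimp only
  rw [hψa θ y, hlin]
  by_cases hy : y ∈ tsupport ψ
  · rw [poloidalPart_rotZ (hrot θ y (hψΩ hy))]
  · have h0 : ψ y = 0 := image_eq_zero_of_notMem_tsupport hy
    rw [h0, zero_smul, zero_smul]

/-- **`ψ V^a` is swirl free.** [folklore] -/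
theorem hasNoSwirl_smul_poloidalPart : HasNoSwirl fun y => ψ y • poloidalPart u y := fun y => by
  rw [swirl_fun_smul, swirl_poloidalPart, mul_zero]

/-- **(4.6) in three dimensions: `div (ψ V^a) = Dψ(V^a) = V^a · ∇ψ`** everywhere, for `u`
divergence free, `C¹` and equivariant at the points of the open set `Ω ⊇ tsupport ψ` off the axis
(Seregin–Zajaczkowski 2007, (4.6); the planar divergence there differs from the three-dimensional
one by `Ṽ_ϱ/ϱ`). [cite: SereginZajaczkowski2007, Lemma 4.2 proof, (4.6)] -/
theorem divergence_smul_poloidalPart (h0 : 0 < ρ₀) (hΩρ : ∀ y ∈ Ω, ρ₀ ≤ cylRadius y)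
    (hu : ∀ y ∈ Ω, ContDiffAt ℝ 2 u y) (hrot : ∀ θ : ℝ, ∀ y ∈ Ω, u (rotZ θ y) = rotZ θ (u y))
    (hdiv : ∀ y ∈ Ω, VectorCalculus.divergence u y = 0) (hψ : ContDiff ℝ 2 ψ)
    (hψΩ : tsupport ψ ⊆ Ω) (y : EuclideanSpace ℝ (Fin 3)) :
    VectorCalculus.divergence (fun x => ψ x • poloidalPart u x) y =
      fderiv ℝ ψ y (poloidalPart u y) := by
  by_cases hy : y ∈ tsupport ψ
  · have hyΩ : y ∈ Ω := hψΩ hy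
    have hr : cylRadius y ≠ 0 := (h0.trans_le (hΩρ y hyΩ)).ne'
    have hd : DifferentiableAt ℝ u y := (hu y hyΩ).differentiableAt (by norm_num)
    have hψd : DifferentiableAt ℝ ψ y := (hψ.differentiable (by norm_num)) y
    rw [divergence_smul_apply hψd (differentiableAt_poloidalPart hd hr),
      divergence_poloidalPart hd hr (fun θ => hrot θ y hyΩ), hdiv y hyΩ, mul_zero, zero_add,
      real_inner_comm, gradient, InnerProductSpace.toDual_symm_apply]
  · have hy' : y ∉ tsupport (fun x => ψ x • poloidalPart u x) :=
      fun h => hy (tsupport_smul_poloidalPart_subset h)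
    rw [divergence_eq_zero_of_notMem_tsupport hy', fderiv_of_notMem_tsupport ℝ hy,
      zero_apply]

/-- **(4.7) in three dimensions: `‖curl (ψ V^a)‖ ≤ |ψ| |ω_φ| + ‖curlCLM‖ ‖Dψ‖ ‖V^a‖`** everywhere,
`ω_φ = swirlVelocity (curl u)`, for `u` of class `C²` and equivariant at the points of the open set
`Ω ⊇ tsupport ψ` off the axis and `ψ` an axisymmetric `C²` cut-off (Seregin–Zajaczkowski 2007,
(4.7): `Ṽ_{ϱ,3} - Ṽ_{3,ϱ} = χ̃ + V_ϱψ_{,3} - V₃ψ_{,ϱ}`; here: the swirl-free axisymmetric field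
`ψ V^a` has toroidal curl, whose `φ`-component is `ψ (curl V^a)_φ + (∇ψ × V^a)_φ` with
`(curl V^a)_φ = ω_φ`). [cite: SereginZajaczkowski2007, Lemma 4.2 proof, (4.7)] -/
theorem norm_curl_smul_poloidalPart_le (h0 : 0 < ρ₀)
    (hΩρ : ∀ y ∈ Ω, ρ₀ ≤ cylRadius y) (hu : ∀ y ∈ Ω, ContDiffAt ℝ 2 u y)
    (hrot : ∀ θ : ℝ, ∀ y ∈ Ω, u (rotZ θ y) = rotZ θ (u y)) (hψ : ContDiff ℝ 2 ψ)
    (hψa : IsAxisymmetricScalar ψ) (hψΩ : tsupport ψ ⊆ Ω) (y : EuclideanSpace ℝ (Fin 3)) :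
    ‖curl (fun x => ψ x • poloidalPart u x) y‖ ≤
      |ψ y| * |swirlVelocity (curl u) y| +
        ‖curlCLM‖ * ‖fderiv ℝ ψ y‖ * ‖poloidalPart u y‖ := by
  set W : EuclideanSpace ℝ (Fin 3) → EuclideanSpace ℝ (Fin 3) := fun x => ψ x • poloidalPart u x
    with hW
  have hW2 : ContDiff ℝ 2 W := contDiff_smul_poloidalPart h0 hΩρ hu hψ hψΩ
  have hW1 : ContDiff ℝ 1 W := hW2.of_le (by norm_num)
  have hax : IsAxisymmetric W := isAxisymmetric_smul_poloidalPart hrot hψa hψΩ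
  have hsw : HasNoSwirl W := hasNoSwirl_smul_poloidalPart
  by_cases hy : y ∈ tsupport ψ
  · have hyΩ : y ∈ Ω := hψΩ hy
    have hr : cylRadius y ≠ 0 := (h0.trans_le (hΩρ y hyΩ)).ne'
    have hd : DifferentiableAt ℝ u y := (hu y hyΩ).differentiableAt (by norm_num)
    have hψd : DifferentiableAt ℝ ψ y := (hψ.differentiable (by norm_num)) y
    have hsq := norm_curl_sq_eq_swirlVelocity_sq hax hsw hW1 (y := y) (Or.inl hr)
    have habs : ‖curl W y‖ = |swirlVelocity (curl W) y| := by
      have h := congrArg Real.sqrt hsq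
      rwa [Real.sqrt_sq (norm_nonneg _), Real.sqrt_sq_eq_abs] at h
    -- the `φ`-component by the Leibniz rule
    have hcurl : curl W y = ψ y • curl (poloidalPart u) y +
        curlCLM ((fderiv ℝ ψ y).smulRight (poloidalPart u y)) :=
      curl_smul hψd (differentiableAt_poloidalPart hd hr)
    have hsv : swirlVelocity (curl W) y = ψ y * swirlVelocity (curl u) y +
        ⟪curlCLM ((fderiv ℝ ψ y).smulRight (poloidalPart u y)), eTheta y⟫ := by
      rw [swirlVelocity, hcurl, inner_add_left, inner_smul_left, RCLike.conj_to_real,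
        ← swirlVelocity_curl_poloidalPart hd hr]
      rfl
    have h1 := abs_swirlVelocity_le (fun _ => curlCLM ((fderiv ℝ ψ y).smulRight (poloidalPart u y))) y
    simp only [swirlVelocity] at h1
    have h2 := norm_curlCLM_smulRight_le (fderiv ℝ ψ y) (poloidalPart u y)
    have h3 : |⟪curlCLM ((fderiv ℝ ψ y).smulRight (poloidalPart u y)), eTheta y⟫| ≤
        ‖curlCLM‖ * ‖fderiv ℝ ψ y‖ * ‖poloidalPart u y‖ := by
      refine h1.trans ?_
      rw [← mul_assoc] at h2
      exact h2
    rw [habs, hsv]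
    calc |ψ y * swirlVelocity (curl u) y +
          ⟪curlCLM ((fderiv ℝ ψ y).smulRight (poloidalPart u y)), eTheta y⟫|
        ≤ |ψ y * swirlVelocity (curl u) y| +
          |⟪curlCLM ((fderiv ℝ ψ y).smulRight (poloidalPart u y)), eTheta y⟫| := abs_add_le _ _
      _ ≤ |ψ y| * |swirlVelocity (curl u) y| +
          ‖curlCLM‖ * ‖fderiv ℝ ψ y‖ * ‖poloidalPart u y‖ := by
          rw [abs_mul]
          exact add_le_add le_rfl h3
  · have hy' : y ∉ tsupport W := fun h => hy (tsupport_smul_poloidalPart_subset h)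
    rw [curl_eq_zero_of_notMem_tsupport hy', norm_zero]
    positivity

/-! ### The `L²` bound on the gradient of `ψ V^a` -/

/-- Pointwise: `‖curl (ψV^a)‖² + (div (ψV^a))² ≤ 2 ψ² ω_φ² + (2‖curlCLM‖² + 1) ‖Dψ‖² ‖V^a‖²`.
[folklore] -/
theorem norm_curl_sq_add_divergence_sq_le (h0 : 0 < ρ₀)
    (hΩρ : ∀ y ∈ Ω, ρ₀ ≤ cylRadius y) (hu : ∀ y ∈ Ω, ContDiffAt ℝ 2 u y)
    (hrot : ∀ θ : ℝ, ∀ y ∈ Ω, u (rotZ θ y) = rotZ θ (u y))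
    (hdiv : ∀ y ∈ Ω, VectorCalculus.divergence u y = 0) (hψ : ContDiff ℝ 2 ψ)
    (hψa : IsAxisymmetricScalar ψ) (hψΩ : tsupport ψ ⊆ Ω) (y : EuclideanSpace ℝ (Fin 3)) :
    ‖curl (fun x => ψ x • poloidalPart u x) y‖ ^ 2 +
        VectorCalculus.divergence (fun x => ψ x • poloidalPart u x) y ^ 2 ≤
      2 * (ψ y ^ 2 * swirlVelocity (curl u) y ^ 2) +
        (2 * ‖curlCLM‖ ^ 2 + 1) * (‖fderiv ℝ ψ y‖ ^ 2 * ‖poloidalPart u y‖ ^ 2) := by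
  have hc := norm_curl_smul_poloidalPart_le h0 hΩρ hu hrot hψ hψa hψΩ y
  have hd := divergence_smul_poloidalPart h0 hΩρ hu hrot hdiv hψ hψΩ y
  set a := |ψ y| * |swirlVelocity (curl u) y| with ha
  set b := ‖curlCLM‖ * ‖fderiv ℝ ψ y‖ * ‖poloidalPart u y‖ with hb
  have ha0 : 0 ≤ a := by positivity
  have hb0 : 0 ≤ b := by positivity
  have h1 : ‖curl (fun x => ψ x • poloidalPart u x) y‖ ^ 2 ≤ 2 * a ^ 2 + 2 * b ^ 2 := by
    calc ‖curl (fun x => ψ x • poloidalPart u x) y‖ ^ 2 ≤ (a + b) ^ 2 :=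
          pow_le_pow_left₀ (norm_nonneg _) hc 2
      _ ≤ 2 * a ^ 2 + 2 * b ^ 2 := by nlinarith [sq_nonneg (a - b)]
  have h2 : VectorCalculus.divergence (fun x => ψ x • poloidalPart u x) y ^ 2 ≤
      ‖fderiv ℝ ψ y‖ ^ 2 * ‖poloidalPart u y‖ ^ 2 := by
    rw [hd, ← mul_pow]
    have h := ContinuousLinearMap.le_opNorm (fderiv ℝ ψ y) (poloidalPart u y)
    rw [Real.norm_eq_abs] at h
    exact (sq_abs _).symm.le.trans (pow_le_pow_left₀ (abs_nonneg _) h 2)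
  have ea : a ^ 2 = ψ y ^ 2 * swirlVelocity (curl u) y ^ 2 := by
    rw [ha, mul_pow, sq_abs, sq_abs]
  have eb : b ^ 2 = ‖curlCLM‖ ^ 2 * (‖fderiv ℝ ψ y‖ ^ 2 * ‖poloidalPart u y‖ ^ 2) := by
    rw [hb]; ring
  nlinarith [h1, h2, ea, eb]

/-- **The `L²` gradient bound for the cut-off poloidal part** (Seregin–Zajaczkowski 2007,
proof of Lemma 4.2: "According to (4.6) and (4.7), one may conclude
`∫∫ |∇_a Ṽ|² dϱ dx₃ ≤ c ∫∫ (|χ̃|² + |V^a|²) dϱ dx₃`", arXiv p. 6). Let `Ω ⊆ {ρ₀ ≤ |x'|}` be open,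
`ρ₀ > 0`, let `u` be `C²`, divergence free and equivariant under the rotations about the axis at
the points of `Ω`, and let `ψ` be an axisymmetric `C²` cut-off with compact support
`tsupport ψ ⊆ Ω`. Then
`∫ |D(ψ V^a)|²_F ≤ 2 ∫ ψ² ω_φ² + (2‖curlCLM‖² + 1) ∫ ‖Dψ‖² ‖V^a‖²`
(`ω_φ = swirlVelocity (curl u)`, `V^a = poloidalPart u`), by the `div`–`curl` identity for the
compactly supported `C²` field `ψ V^a` and the pointwise bounds (4.6)–(4.7).
[cite: SereginZajaczkowski2007, Lemma 4.2 proof, display after (4.7) (arXiv p. 6)] -/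
theorem integral_frobeniusNormSq_fderiv_smul_poloidalPart_le (h0 : 0 < ρ₀)
    (hΩρ : ∀ y ∈ Ω, ρ₀ ≤ cylRadius y) (hu : ∀ y ∈ Ω, ContDiffAt ℝ 2 u y)
    (hrot : ∀ θ : ℝ, ∀ y ∈ Ω, u (rotZ θ y) = rotZ θ (u y))
    (hdiv : ∀ y ∈ Ω, VectorCalculus.divergence u y = 0) (hψ : ContDiff ℝ 2 ψ)
    (hψc : HasCompactSupport ψ) (hψa : IsAxisymmetricScalar ψ) (hψΩ : tsupport ψ ⊆ Ω)
    (hI1 : Integrable fun y => ψ y ^ 2 * swirlVelocity (curl u) y ^ 2)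
    (hI2 : Integrable fun y => ‖fderiv ℝ ψ y‖ ^ 2 * ‖poloidalPart u y‖ ^ 2) :
    ∫ y, frobeniusNormSq (fderiv ℝ (fun x => ψ x • poloidalPart u x) y) ≤
      (2 * ∫ y, ψ y ^ 2 * swirlVelocity (curl u) y ^ 2) +
        (2 * ‖curlCLM‖ ^ 2 + 1) * ∫ y, ‖fderiv ℝ ψ y‖ ^ 2 * ‖poloidalPart u y‖ ^ 2 := by
  set W : EuclideanSpace ℝ (Fin 3) → EuclideanSpace ℝ (Fin 3) := fun x => ψ x • poloidalPart u x
    with hW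
  have hW2 : ContDiff ℝ 2 W := contDiff_smul_poloidalPart h0 hΩρ hu hψ hψΩ
  have hW1 : ContDiff ℝ 1 W := hW2.of_le (by norm_num)
  have hWc : HasCompactSupport W := hasCompactSupport_smul_poloidalPart hψc
  rw [integral_frobeniusNormSq_fderiv_eq_of_hasCompactSupport hW2 hWc]
  -- integrability of the two summands (continuous, compactly supported)
  have hD0 : ∀ x ∉ tsupport W, fderiv ℝ W x = 0 := fun x hx =>
    image_eq_zero_of_notMem_tsupport fun h => hx (tsupport_fderiv_subset ℝ h)
  have hic : Integrable fun y => ‖curl W y‖ ^ 2 := by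
    have hcc : Continuous fun x => ‖curl W x‖ ^ 2 := by
      rw [curl_eq_curlCLM_comp]
      exact (curlCLM.continuous.comp (hW1.continuous_fderiv one_ne_zero)).norm.pow 2
    refine hcc.integrable_of_hasCompactSupport (HasCompactSupport.intro hWc.isCompact fun x hx => ?_)
    rw [curl_eq_curlCLM_comp]
    simp [hD0 x hx]
  have hid : Integrable fun y => VectorCalculus.divergence W y ^ 2 := by
    have hcd : Continuous fun x => VectorCalculus.divergence W x ^ 2 :=
      (continuous_divergence (hW1.continuous_fderiv one_ne_zero)).pow 2
    refine hcd.integrable_of_hasCompactSupport (HasCompactSupport.intro hWc.isCompact fun x hx => ?_)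
    rw [divergence_eq_zero_of_notMem_tsupport hx]; ring
  have hR : ∫ y, (2 * (ψ y ^ 2 * swirlVelocity (curl u) y ^ 2) +
      (2 * ‖curlCLM‖ ^ 2 + 1) * (‖fderiv ℝ ψ y‖ ^ 2 * ‖poloidalPart u y‖ ^ 2)) =
      (2 * ∫ y, ψ y ^ 2 * swirlVelocity (curl u) y ^ 2) +
        (2 * ‖curlCLM‖ ^ 2 + 1) * ∫ y, ‖fderiv ℝ ψ y‖ ^ 2 * ‖poloidalPart u y‖ ^ 2 := by
    rw [integral_add (hI1.const_mul 2) (hI2.const_mul _), integral_const_mul, integral_const_mul]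
  rw [← hR, ← integral_add hic hid]
  refine integral_mono (hic.add hid) ((hI1.const_mul 2).add (hI2.const_mul _)) fun y => ?_
  exact norm_curl_sq_add_divergence_sq_le h0 hΩρ hu hrot hdiv hψ hψa hψΩ y

end Cutoff

end Literature.Analysis.FluidPDE
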